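import Mathlib
import Literature.Computability.AlgebraicComplexity.LinSubst
import Summits.ValiantsHypothesis.ValiantsHypothesis.Theorems.BorderApolarityFixedWitnessObstructionQPInterp

/-!
# Border apolarity, crux `ToricWitnessObstructionQP` (stmt-ValiantsHypothesis-14753) — line `Sketch`,
# reshape 4: CONTENT GRADING — a space of forms stable under a one-parameter torus `x_i ↦ c^{e_i} x_i`
# (`e : σ → ℤ`) contains the `e`-isotypic components of its elements

Route `ValiantsHypothesis/BorderApolarity`, crux item `stmt-ValiantsHypothesis-14753`, line `Sketch`
(lead c3).  The clean pattern-torus stability (ST) of the residual `stub_noStableNormalFormQP` says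
that each initial span `J' k` is stable under `linSubst (diagonal t)` for every `t` with `t = 1` on the
unused variables, rank-one pattern `t_(i,j) t_(k,l) = t_(i,l) t_(k,j)` on the block and character
`t₀₀^{m-n} ∏ t_(i,i) = 1`.  Every INTEGER vector `e` with `e = 0` off the own variables,
`e_(i,j) = a_i + b_j` on the block and `(m - n) e₀₀ + Σ_i (a_i + b_i) = 0` is a cocharacter of that
torus (`t := c ^ e`, `c ≠ 0`), and such cocharacters separate the CONTENTS
(`x₀₀`-degree, row sums, column sums) of the own monomials of any fixed degree.  This file proves the
general fact behind "the initial spans are content-graded":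

* `snf_cocharacterComponent_mem`: if a subspace `J` of degree-`k` forms is stable under
  `linSubst (diagonal fun i => c ^ e i)` for all `c ≠ 0` (`e : σ → ℤ`, integer exponents, `zpow`),
  then `J` contains every `e`-isotypic component `weightedHomogeneousComponent e ν f` of every
  `f ∈ J`.  Proof: shift `e` by a constant `K` to a nonnegative weight `e'`; on degree-`k` forms the
  `e'`-substitute is `c ^ (K k)` times the `e`-substitute (so `J` is stable under it as well), the
  `e'`-components are the `e`-components (weights shifted by `K k`), and the `ℕ`-weight interpolation
  `BorderApolarityFixedWitnessObstructionQP.stub_interp` (Vandermonde at the nodes `1, …, N+1`)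
  expresses each component through substitutes.
* `snf_patternComponent_mem`: the specialisation to the (ST) clause of the residual, verbatim: for
  every integer pattern vector `e` as above, each `J' k` (`k ≤ m`) contains the `e`-components of its
  elements.  With `e` generic this is the content grading of `J' k` (and, dually, of
  `M_k = (J' k)^⊥`), used throughout the structure theory of stable normal forms.
-/

open MvPolynomial
open scoped BigOperators Matrix
open Literature.Computability.AlgebraicComplexity

-- the mandated summit-side namespace repeats a component by design (single-problem summit)
set_option linter.dupNamespace false

namespace Summit.ValiantsHypothesis.ValiantsHypothesis.Theorems.BorderApolarityToricWitnessObstructionQP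

section General

variable {σ : Type*} [Fintype σ] [DecidableEq σ]

omit [Fintype σ] [DecidableEq σ] in
/-- Integer weights differ from their shift by `K` by `K · degree` on every monomial:
`weight (e + K) d = weight e d + K * |d|`. [folklore] -/
theorem snfcg_weight_shift (e : σ → ℤ) (K : ℤ) (d : σ →₀ ℕ) :
    Finsupp.weight (fun i => e i + K) d = Finsupp.weight e d + K * (Finsupp.weight (1 : σ → ℕ) d : ℕ) := by
  simp only [Finsupp.weight_apply, Pi.one_apply, smul_eq_mul, mul_one, nsmul_eq_mul]
  rw [Finsupp.sum, Finsupp.sum, Finsupp.sum, Nat.cast_sum, Finset.mul_sum, ← Finset.sum_add_distrib]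
  refine Finset.sum_congr rfl fun i _ => ?_
  ring

omit [Fintype σ] [DecidableEq σ] in
/-- `c ^ (Σ f) = ∏ c ^ f` for integer exponents and `c ≠ 0`. [folklore] -/
theorem snfcg_zpow_sum {ι : Type*} (s : Finset ι) (g : ι → ℤ) {c : ℂ} (hc : c ≠ 0) :
    c ^ (∑ i ∈ s, g i) = ∏ i ∈ s, c ^ (g i) := by
  classical
  induction s using Finset.induction_on with
  | empty => simp
  | insert a s ha ih => rw [Finset.sum_insert ha, Finset.prod_insert ha, zpow_add₀ hc, ih]

/-- The torus substitute with integer exponents scales the coefficient of `x^d` by `c ^ weight e d`.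
[folklore] -/
theorem snfcg_coeff_linSubst_diagonal_zpow (e : σ → ℤ) {c : ℂ} (hc : c ≠ 0) (f : MvPolynomial σ ℂ)
    (d : σ →₀ ℕ) :
    coeff d (linSubst σ ℂ (Matrix.diagonal fun i => c ^ (e i)) f) = c ^ (Finsupp.weight e d) * coeff d f := by
  rw [BorderApolarityFixedWitnessObstructionQP.coeff_linSubst_diagonal]
  congr 1
  rw [Finsupp.weight_apply, Finsupp.prod, Finsupp.sum, snfcg_zpow_sum _ _ hc]
  refine Finset.prod_congr rfl fun i _ => ?_
  rw [nsmul_eq_mul, ← zpow_natCast, ← zpow_mul, mul_comm]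

/-- On a form of degree `k`, shifting the integer exponents by `K` multiplies the torus substitute by
`c ^ (K k)`. [folklore] -/
theorem snfcg_linSubst_shift (e : σ → ℤ) (K : ℤ) {c : ℂ} (hc : c ≠ 0) {f : MvPolynomial σ ℂ} {k : ℕ}
    (hf : f.IsHomogeneous k) :
    linSubst σ ℂ (Matrix.diagonal fun i => c ^ (e i + K)) f =
      c ^ (K * k) • linSubst σ ℂ (Matrix.diagonal fun i => c ^ (e i)) f := by
  ext d
  rw [coeff_smul, snfcg_coeff_linSubst_diagonal_zpow _ hc, snfcg_coeff_linSubst_diagonal_zpow _ hc,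
    smul_eq_mul]
  by_cases hd : coeff d f = 0
  · rw [hd, mul_zero, mul_zero, mul_zero]
  · have hdeg : (Finsupp.weight (1 : σ → ℕ) d : ℕ) = k := hf hd
    rw [snfcg_weight_shift, hdeg, zpow_add₀ hc, ← mul_assoc, mul_comm (c ^ Finsupp.weight e d)]

omit [Fintype σ] [DecidableEq σ] in
/-- Components for shifted weights: on a form of degree `k`, the `(e + K)`-component of weight
`ν + K k` is the `e`-component of weight `ν`. [folklore] -/
theorem snfcg_component_shift (e : σ → ℤ) (K ν : ℤ) {f : MvPolynomial σ ℂ} {k : ℕ}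
    (hf : f.IsHomogeneous k) :
    weightedHomogeneousComponent (fun i => e i + K) (ν + K * k) f = weightedHomogeneousComponent e ν f := by
  ext d
  rw [coeff_weightedHomogeneousComponent, coeff_weightedHomogeneousComponent]
  by_cases hd : coeff d f = 0
  · simp [hd]
  · have hdeg : (Finsupp.weight (1 : σ → ℕ) d : ℕ) = k := hf hd
    rw [snfcg_weight_shift, hdeg]
    by_cases h : Finsupp.weight e d = ν
    · rw [if_pos (by rw [h]), if_pos h]
    · rw [if_neg (fun h' => h (by linarith)), if_neg h]

omit [Fintype σ] [DecidableEq σ] in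
/-- An integer weight with nonnegative values is the cast of a natural weight, and the integer
`weightedHomogeneousComponent` is the natural one. [folklore] -/
theorem snfcg_component_toNat (e : σ → ℤ) (he : ∀ i, 0 ≤ e i) (r : ℕ) (f : MvPolynomial σ ℂ) :
    weightedHomogeneousComponent e (r : ℤ) f =
      weightedHomogeneousComponent (fun i => (e i).toNat) r f := by
  have hcast : ∀ d : σ →₀ ℕ, Finsupp.weight e d = ((Finsupp.weight (fun i => (e i).toNat) d : ℕ) : ℤ) := by
    intro d
    simp only [Finsupp.weight_apply, nsmul_eq_mul, smul_eq_mul]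
    rw [Finsupp.sum, Finsupp.sum, Nat.cast_sum]
    refine Finset.sum_congr rfl fun i _ => ?_
    push_cast
    rw [Int.toNat_of_nonneg (he i)]
  ext d
  rw [coeff_weightedHomogeneousComponent, coeff_weightedHomogeneousComponent, hcast d]
  by_cases h : Finsupp.weight (fun i => (e i).toNat) d = r
  · rw [if_pos (by rw [h]), if_pos h]
  · rw [if_neg (fun h' => h (by exact_mod_cast h')), if_neg h]

omit [Fintype σ] in
/-- The natural-exponent torus substitute of a nonnegative integer weight is the integer one.
[folklore] -/
theorem snfcg_diagonal_toNat (e : σ → ℤ) (he : ∀ i, 0 ≤ e i) (c : ℂ) :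
    (Matrix.diagonal fun i => c ^ ((e i).toNat)) = Matrix.diagonal fun i => c ^ (e i) := by
  congr 1
  funext i
  rw [← zpow_natCast, Int.toNat_of_nonneg (he i)]

/-- **Isotypic components from one-parameter torus stability (integer exponents).**  If a subspace
`J` of degree-`k` forms is stable under `linSubst (diagonal fun i => c ^ e i)` for every `c ≠ 0`
(`e : σ → ℤ`), then `J` contains every `e`-isotypic component of each of its elements. [folklore] -/
theorem snf_cocharacterComponent_mem : ∀ {σ : Type} [Fintype σ] [DecidableEq σ]
    (J : Submodule ℂ (MvPolynomial σ ℂ)) (k : ℕ),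
    J ≤ MvPolynomial.homogeneousSubmodule σ ℂ k →
    ∀ e : σ → ℤ,
    (∀ c : ℂ, c ≠ 0 → ∀ f ∈ J, linSubst σ ℂ (Matrix.diagonal fun i => c ^ (e i)) f ∈ J) →
    ∀ f ∈ J, ∀ ν : ℤ, weightedHomogeneousComponent e ν f ∈ J := by
  intro σ _ _ J k hJ e hstab f hf ν
  have hfh : f.IsHomogeneous k := (MvPolynomial.mem_homogeneousSubmodule k f).1 (hJ hf)
  -- shift to a nonnegative weight `e' = e + K`
  obtain ⟨K, hK⟩ : ∃ K : ℤ, ∀ i, 0 ≤ e i + K := by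
    refine ⟨∑ i, |e i|, fun i => ?_⟩
    have h1 : |e i| ≤ ∑ j, |e j| := Finset.single_le_sum (f := fun j => |e j|) (fun j _ => abs_nonneg _)
      (Finset.mem_univ i)
    have h2 : -e i ≤ |e i| := neg_le_abs (e i)
    linarith
  set e' : σ → ℤ := fun i => e i + K with he'
  -- stability under the shifted substitutes
  have hstab' : ∀ c : ℂ, c ≠ 0 → ∀ g ∈ J,
      linSubst σ ℂ (Matrix.diagonal fun i => c ^ ((e' i).toNat)) g ∈ J := by
    intro c hc g hg
    have hgh : g.IsHomogeneous k := (MvPolynomial.mem_homogeneousSubmodule k g).1 (hJ hg)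
    rw [snfcg_diagonal_toNat e' hK c]
    show linSubst σ ℂ (Matrix.diagonal fun i => c ^ (e i + K)) g ∈ J
    rw [snfcg_linSubst_shift e K hc hgh]
    exact J.smul_mem _ (hstab c hc g hg)
  -- the `e`-component of weight `ν` is the `e'`-component of weight `ν + K k`
  rw [← snfcg_component_shift e K ν hfh]
  by_cases hneg : ν + K * k < 0
  · -- no monomial of degree `k` has negative `e'`-weight: the component vanishes
    have h0 : weightedHomogeneousComponent (fun i => e i + K) (ν + K * k) f = 0 := by
      ext d
      rw [coeff_weightedHomogeneousComponent, coeff_zero]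
      by_cases hd : coeff d f = 0
      · simp [hd]
      · rw [if_neg]
        intro h
        have hnn : 0 ≤ Finsupp.weight (fun i => e i + K) d := by
          simp only [Finsupp.weight_apply, nsmul_eq_mul]
          rw [Finsupp.sum]
          exact Finset.sum_nonneg fun i _ => mul_nonneg (Int.natCast_nonneg _) (hK i)
        rw [h] at hnn
        exact absurd hnn (not_le.2 hneg)
    rw [h0]
    exact J.zero_mem
  · -- interpolate with the natural weight `e'.toNat`
    obtain ⟨r, hr⟩ : ∃ r : ℕ, (r : ℤ) = ν + K * k := ⟨(ν + K * k).toNat, Int.toNat_of_nonneg (not_lt.1 hneg)⟩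
    rw [← hr]
    show weightedHomogeneousComponent e' (r : ℤ) f ∈ J
    rw [snfcg_component_toNat e' hK r f]
    obtain ⟨a, ha⟩ := BorderApolarityFixedWitnessObstructionQP.stub_interp σ (fun i => (e' i).toNat)
      (f.support.sup fun d => Finsupp.weight (fun i => (e' i).toNat) d) r f
      (fun d hd => Finset.le_sup (f := fun d => Finsupp.weight (fun i => (e' i).toNat) d) hd)
    rw [ha]
    refine J.sum_mem fun j _ => J.smul_mem _ ?_
    exact hstab' _ (Nat.cast_add_one_ne_zero _) f hf

end General

/-! ## Specialisation to the residual's pattern torus -/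

/-- **Content grading of the initial spans (lead c3).**  Let `J'` satisfy the clean pattern-torus
clause (ST) of `stub_noStableNormalFormQP` and let each `J' k` (`k ≤ m`) be a subspace of degree-`k`
forms.  Then for every INTEGER pattern vector `e` — `e = 0` on the unused variables,
`e (i,j) + e (k,l) = e (i,l) + e (k,j)` on the block and `(m - n) • e (0,0) + Σ_{i ≥ m-n} e (i,i) = 0` —
each `J' k` contains the `e`-isotypic components of its elements (the substitutes `c ^ e`, `c ≠ 0`, are
elements of the clean pattern torus).  Choosing `e` generic separates all contents
(`x₀₀`-degree, row sums, column sums) of the own monomials of degree `k`, so every `J' k` is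
CONTENT-GRADED. [folklore] -/
theorem snf_patternComponent_mem : ∀ (n m : ℕ) [NeZero m]
    (J' : ℕ → Submodule ℂ (MvPolynomial (Fin m × Fin m) ℂ)),
    (∀ k ≤ m, J' k ≤ MvPolynomial.homogeneousSubmodule (Fin m × Fin m) ℂ k) →
    (∀ t : Fin m × Fin m → ℂ, (∀ i, t i ≠ 0) →
      (∀ z : Fin m × Fin m, ¬ (((m - n ≤ (z.1 : ℕ) ∧ m - n ≤ (z.2 : ℕ)) ∨ z = (0, 0))) → t z = 1) →
      (∀ i k j l : Fin m, m - n ≤ (i : ℕ) → m - n ≤ (k : ℕ) → m - n ≤ (j : ℕ) → m - n ≤ (l : ℕ) →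
        t (i, j) * t (k, l) = t (i, l) * t (k, j)) →
      t (0, 0) ^ (m - n) * ∏ i ∈ Finset.univ.filter (fun i : Fin m => m - n ≤ (i : ℕ)), t (i, i) = 1 →
      ∀ k ≤ m, ∀ D ∈ J' k, linSubst (Fin m × Fin m) ℂ (Matrix.diagonal t) D ∈ J' k) →
    ∀ e : Fin m × Fin m → ℤ,
      (∀ z : Fin m × Fin m, ¬ (((m - n ≤ (z.1 : ℕ) ∧ m - n ≤ (z.2 : ℕ)) ∨ z = (0, 0))) → e z = 0) →
      (∀ i k j l : Fin m, m - n ≤ (i : ℕ) → m - n ≤ (k : ℕ) → m - n ≤ (j : ℕ) → m - n ≤ (l : ℕ) →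
        e (i, j) + e (k, l) = e (i, l) + e (k, j)) →
      ((m - n : ℕ) : ℤ) * e (0, 0) + ∑ i ∈ Finset.univ.filter (fun i : Fin m => m - n ≤ (i : ℕ)), e (i, i) = 0 →
      ∀ k ≤ m, ∀ D ∈ J' k, ∀ ν : ℤ, weightedHomogeneousComponent e ν D ∈ J' k := by
  intro n m _ J' hJ hST e he0 hadd hchar k hk D hD ν
  refine snf_cocharacterComponent_mem (J' k) k (hJ k hk) e ?_ D hD ν
  intro c hc f hf
  refine hST (fun i => c ^ (e i)) (fun i => zpow_ne_zero _ hc) ?_ ?_ ?_ k hk f hf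
  · intro z hz
    show c ^ (e z) = 1
    rw [he0 z hz, zpow_zero]
  · intro i k' j l hi hk' hj hl
    show c ^ e (i, j) * c ^ e (k', l) = c ^ e (i, l) * c ^ e (k', j)
    rw [← zpow_add₀ hc, ← zpow_add₀ hc, hadd i k' j l hi hk' hj hl]
  · show (c ^ e (0, 0)) ^ (m - n) * ∏ i ∈ Finset.univ.filter (fun i : Fin m => m - n ≤ (i : ℕ)), c ^ e (i, i) = 1
    rw [← zpow_natCast, ← zpow_mul, ← snfcg_zpow_sum _ _ hc, ← zpow_add₀ hc, mul_comm, hchar, zpow_zero]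

end Summit.ValiantsHypothesis.ValiantsHypothesis.Theorems.BorderApolarityToricWitnessObstructionQP
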